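import Mathlib
import Summits.ResolutionOfSingularities.ResolutionOfSingularities.Theorems.HomologicalConductorPersistenceCyclicQuotientOneModQ
import Summits.ResolutionOfSingularities.ResolutionOfSingularities.Theorems.HomologicalConductorPersistenceCyclicQuotientGreedyStaircase
import HarnessLib

/-!
# Rung S-2 `PersistenceSurface` (stmt-19970), stub C1 (`Sat₄`) — `ca = ca⁴` with the EXACT CENTRE for EVERY cyclic
# quotient surface singularity `1/n(1,q)`: `ca(k[u,v]^{μ_n(1,q)}) = ca⁴ = ⋂_{t=1}^{e} s̲ann(M_{−i_t})`
# (chain W4.4b; T-V package, assembly of the toric class; seat leafhand-res-homologicalconduct-13 gen 1)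

[OURS · cell decomp-res · rung S-2] Nothing here is a statement of the manuscript under review (Hironaka 2017);
AI-written, weaker than expert review.

Route `ResolutionOfSingularities/HomologicalConductor`, registered stub `stub_saturationFourSurfaceResidualFour`
(`Sat₄` residual), class (iii) «`Sat₄` at the non-Gorenstein rational (toric) stages».  Parts 25–30
(`…CyclicQuotient{OneTwo,NMinusTwo,OneModQ,MinusOneModQ,MinusTwoModQ,PlusTwoModQ}`) certified `ca(U) = ca⁴(U)` for the
families `n ≡ ±1, ±2 (mod q)`.  This file closes the WHOLE TORIC CLASS: for `U = k[u,v]^{μ_n(1,q)}` (`ζ ∈ k` a primitive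
`n`-th root of unity, `n ∈ kˣ`, `σ₀ : u ↦ ζu, v ↦ ζ^q v`, `U = {p | σ₀ p = p}`) and ANY `q` coprime to `n`:

* **`cohomologyAnnihilator_cyclicQuotient_of_chain`** — with the Hirzebruch–Jung chain `(e, i, b)` of `n/q`
  (`i 0 = n`, `i 1 = q`, `i e = 1`, `i (e+1) = 0`, `i (s-1) + i (s+1) = b s · i s`, `b s ≥ 2`; the `i`-series) and
  the weight pieces `M a = {p | σ₀ p = ζ^a p}`: `ca(U) = ca⁴(U)` and
  `x ∈ ca(U) ↔ ∀ t < e, x` stably annihilates `M_{−i (t+1)}` — the centre is cut out by the `e` COSPECIAL pieces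
  (duals of Wunram's specials `M_{i_1}, …, M_{i_e}`), one per exceptional curve of the minimal resolution.
* **`cohomologyAnnihilator_eq_four_cyclicQuotient`** — for every `q` coprime to `n` (any residue, `n = 1` included):
  `ca(k[u,v]^{μ_n(1,q)}) = ca⁴(k[u,v]^{μ_n(1,q)})`.

PROOF = the assembly announced in parts 22 and HAND13-NUMERATION §2: per class `a` the GREEDY STAIRCASE of part
`…GreedyStaircase` (`exists_greedyStaircase`: generators `u^{c t} v^{pos t}`, drops `c t − c (t+1) = i (σ t)`, cover
property via LEMMA F2) feeds `isotypic_le_span_of_cover` + `isSyzygy_one_staircase_of_lt` (parts 21–22), so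
`Ω M_a ≅ Π_{t < μ a} M_{−i (σ a t)} ∈ add (Π_t M_{−i_t})` (Wunram's law, input `hKD`); the NUMERATION LEMMA
`exists_source_of_target` (part 3) with `exists_greedy_hit` gives, for every target `t`, a source `u` with `M_{−i_t}`
a factor of `Ω M_{−i_u}` (input `hD`); `…CyclicQuotientIsotypic.cohomologyAnnihilator_eq_four_of_isotypicData`
(parts 16–18) concludes.  For the reduction to `1 ≤ q < n`: `ζ^q = ζ^{q mod n}`, and `n ∣ q` forces `n = 1` (empty
chain).  By-name status of the four registered stubs is unchanged (they are research statements); this settles the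
toric = cyclic-quotient class of stub 2 unconditionally (for `ζ ∈ k`, `n ∈ kˣ`).

References: folklore (Auslander 1986 / Herzog 1978 mechanism); J. Wunram, Math. Ann. 279 (1988) and
O. Riemenschneider, Math. Ann. 209 (1974) for the classical names (not premises); Iyengar–Takahashi, IMRN 2016,
arXiv:1404.1476 [`IyengarTakahashi2014`] (vocabulary); res-L1-w44b-idea-1 SC-TORIC v2, HAND10G2-TORIC-FAMILIES,
HAND13-NUMERATION (OURS, cell memos).
-/

-- single-problem summit: the doubled namespace component `ResolutionOfSingularities` is forced
set_option linter.dupNamespace false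

noncomputable section

open CategoryTheory Literature.RingTheory.CohomologyAnnihilator MvPolynomial
open Summit.ResolutionOfSingularities.ResolutionOfSingularities.Theorems.NoZeno.SandwichCluster
open Summit.ResolutionOfSingularities.ResolutionOfSingularities.Theorems.HomologicalConductor.PersistenceAddCoverFamily
open Summit.ResolutionOfSingularities.ResolutionOfSingularities.Theorems.HomologicalConductor.PersistenceCyclicQuotientIsotypic
open Summit.ResolutionOfSingularities.ResolutionOfSingularities.Theorems.HomologicalConductor.PersistenceCyclicQuotientIsotypicPieces
open Summit.ResolutionOfSingularities.ResolutionOfSingularities.Theorems.HomologicalConductor.PersistenceStaircaseRecords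
open Summit.ResolutionOfSingularities.ResolutionOfSingularities.Theorems.HomologicalConductor.PersistenceCyclicQuotientOneModQ
  (natCast_val_add_mul_self val_sub_natCast_eq val_neg_natCast)
open Summit.ResolutionOfSingularities.ResolutionOfSingularities.Theorems.HomologicalConductor.PersistenceCyclicQuotientNumeration

universe u

namespace Summit.ResolutionOfSingularities.ResolutionOfSingularities.Theorems.HomologicalConductor.PersistenceCyclicQuotientAll

variable {k : Type u} [Field k] {n : ℕ} [NeZero n] {ζ : k} (hζ : IsPrimitiveRoot ζ n) (hn : (n : k) ≠ 0)
variable {q : ℕ} (U : Subalgebra k (MvPolynomial (Fin 2) k))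
variable (hU : ∀ p, p ∈ U ↔ aeval (fun i : Fin 2 => C (ζ ^ (![1, q] : Fin 2 → ℕ) i) * X i) p = p)

set_option maxHeartbeats 1600000 in
set_option synthInstance.maxHeartbeats 400000 in
include hζ hn hU in
/-- **`Sat₄` AND THE EXACT CENTRE FOR EVERY CYCLIC QUOTIENT SURFACE SINGULARITY `1/n(1,q)`.**  Let `(e, i, b)` be
the Hirzebruch–Jung chain of `n/q` (`i 0 = n`, `i 1 = q`, `i e = 1`, `i (e+1) = 0`, `i (s-1) + i (s+1) = b s · i s`,
`b s ≥ 2` on `[1, e]`).  With the weight pieces `M a = {p | σ₀ p = ζ^a p}` of `k[u,v]` over `U = k[u,v]^{μ_n(1,q)}`: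
`ca(U) = ca⁴(U)` and `x ∈ ca(U) ↔ x` stably annihilates the `e` cospecial pieces `M_{−i_1}, …, M_{−i_e}`.
(Greedy staircases = Wunram's law for `hKD`; numeration lemma for `hD`; parts 16–18 conclude.  Budgets raised
locally as in parts 21–30.) [OURS · cell decomp-res] -/
theorem cohomologyAnnihilator_cyclicQuotient_of_chain {e : ℕ} {i b : ℕ → ℕ} (hi0 : i 0 = n) (hi1 : i 1 = q)
    (hie : i e = 1) (hie1 : i (e + 1) = 0)
    (hrec : ∀ s, 1 ≤ s → s ≤ e → i (s - 1) + i (s + 1) = b s * i s) (hb : ∀ s, 1 ≤ s → s ≤ e → 2 ≤ b s) :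
    ∃ M : ZMod n → Submodule U ((restrictScalarsFunctor U (MvPolynomial (Fin 2) k)).obj
        (ModuleCat.of (MvPolynomial (Fin 2) k) (MvPolynomial (Fin 2) k))),
      (∀ (a : ZMod n) (p : MvPolynomial (Fin 2) k),
        (show ((restrictScalarsFunctor U (MvPolynomial (Fin 2) k)).obj
          (ModuleCat.of (MvPolynomial (Fin 2) k) (MvPolynomial (Fin 2) k))) from p) ∈ M a ↔
        aeval (fun i : Fin 2 => C (ζ ^ (![1, q] : Fin 2 → ℕ) i) * X i) p = C (ζ ^ a.val) * p) ∧
      cohomologyAnnihilator U = cohomologyAnnihilatorOfDegree U 4 ∧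
      ∀ x : U, x ∈ cohomologyAnnihilator U ↔
        ∀ t : Fin e, StablyAnnihilates U x
          (@ModuleCat.of U _ (M (-((i (t.val + 1) : ℕ) : ZMod n))) _
            (M (-((i (t.val + 1) : ℕ) : ZMod n))).module) := by
  classical
  have h2 := two_mul_le_of_chain hrec hb
  have hilt := lt_of_chain hie hie1 h2
  have hile := le_of_chain hie hie1 h2
  obtain ⟨j, hj0, hj1, hjrec, hjmono⟩ := exists_jSeries hb
  -- `q` is coprime to `n` (from `q · j e ≡ i e = 1`, or `n = 1` for the empty chain)
  have hcop : Nat.Coprime q n := by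
    rcases Nat.eq_zero_or_pos e with he0 | he1
    · subst he0
      rw [← hi0, hie]
      exact Nat.coprime_one_right q
    · obtain ⟨kk, hkk⟩ := exists_kSeries hrec hb hj0 hj1 hjrec e he1 (by omega)
      rw [hie, hi0, hi1] at hkk
      rw [Nat.coprime_iff_gcd_eq_one]
      have hd1 : Nat.gcd q n ∣ q * j e := Dvd.dvd.mul_right (Nat.gcd_dvd_left _ _) _
      have hd2 : Nat.gcd q n ∣ n * kk := Dvd.dvd.mul_right (Nat.gcd_dvd_right _ _) _
      rw [← hkk] at hd1
      exact Nat.dvd_one.mp ((Nat.dvd_add_right hd2).mp (by rwa [Nat.add_comm] at hd1))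
  obtain ⟨M, hM, ⟨eM⟩⟩ := exists_isotypic_splitting hζ hn hcop U hU
  -- the greedy staircase of every class
  have hstair := fun a : ZMod n =>
    exists_greedyStaircase hie hie1 hrec hb hj0 hj1 hjrec hjmono a.val (by rw [hi0]; exact ZMod.val_lt a)
  choose μ c pos σ hc0 hpos0 hanti hmono hcμ hafter hdrop hclass hcover using hstair
  -- drop classes
  let d : ZMod n → ℕ → ZMod n := fun a t => -((i (σ a t) : ℕ) : ZMod n)
  -- the class of every generator
  have hcl : ∀ a s, ((c a s + q * pos a s : ℕ) : ZMod n) = a := by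
    intro a s
    obtain ⟨K, hK⟩ := hclass a s
    rw [hi1, hi0] at hK
    rw [hK, Nat.cast_add, Nat.cast_mul, ZMod.natCast_self, zero_mul, add_zero, ZMod.natCast_zmod_val]
  -- the drop classes are the syzygy classes
  have hψ : ∀ a t, t < μ a → d a t = a - ((c a t + q * pos a (t + 1) : ℕ) : ZMod n) := by
    intro a t ht
    obtain ⟨-, -, -, -, -, -, K, hK⟩ := hdrop a t ht
    rw [hi1, hi0] at hK
    dsimp only [d]
    rw [hK, Nat.cast_add, Nat.cast_add, Nat.cast_mul, ZMod.natCast_self, zero_mul, add_zero, ZMod.natCast_zmod_val]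
    ring
  -- `q J ≡ a` for `J = pos a (μ a)`
  have hJ : ∀ a, ((q * pos a (μ a) : ℕ) : ZMod n) = a := by
    intro a
    have h := hcl a (μ a)
    rwa [hcμ a, zero_add] at h
  -- the cover property in `ZMod` form
  have hcov : ∀ a x, x ≤ pos a (μ a) → ∃ s, s ≤ μ a ∧ pos a s ≤ x ∧
      c a s ≤ ((a - ((q * x : ℕ) : ZMod n) : ZMod n)).val := by
    intro a x hx
    obtain ⟨t, htμ, hpt, H⟩ := hcover a x hx
    refine ⟨t, htμ, hpt, H _ (by rw [hi0]; exact ZMod.val_lt _) ?_⟩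
    rw [hi1, hi0]
    refine (ZMod.natCast_eq_natCast_iff _ _ _).mp ?_
    have h := hcl a t
    rw [Nat.cast_add, Nat.cast_mul] at h
    rw [Nat.cast_add, ZMod.natCast_zmod_val, Nat.cast_mul, Nat.cast_mul, Nat.cast_sub hpt]
    linear_combination (-1 : ZMod n) * h
  -- the staircase resolutions `Ω M_a ≅ Π_{t < μ a} M (d a t)`
  let M' : ZMod n → ModuleCat.{u} U := fun a => @ModuleCat.of U _ (M a) _ (M a).module
  let K : ZMod n → ModuleCat.{u} U := fun a => ModuleCat.of U (Π t : Fin (μ a), M (d a t))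
  have hK : ∀ a, IsSyzygy 1 (M' a) (K a) := by
    intro a
    refine isSyzygy_one_staircase_of_lt hζ U hU M hM a (μ a) (c a) (pos a) (hanti a) (hmono a) (hcl a)
      (d a) (hψ a) ?_
    exact isotypic_le_span_of_cover hζ U hU M hM a (μ a) (pos a (μ a)) (c a) (pos a) (hcl a) (hJ a) (hcov a)
  -- the certificate data: the cospecial family `{M_{−i_1}, …, M_{−i_e}}`
  let ψ' : Fin e → ZMod n := fun t => -((i (t.val + 1) : ℕ) : ZMod n)
  have hdψ : ∀ a t, t < μ a → ∃ s : Fin e, d a t = ψ' s := by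
    intro a t ht
    obtain ⟨hs1, hse, -⟩ := hdrop a t ht
    refine ⟨⟨σ a t - 1, by omega⟩, ?_⟩
    simp only [d, ψ', Nat.sub_add_cancel hs1]
  have hfin : ∀ t, Module.Finite U (M' (ψ' t)) := fun t => finite_isotypic hζ q U hU M hM _
  have hKD : ∀ a, IsRetractOfPower (ModuleCat.of U ((Π t, M' (ψ' t)) × U)) (K a) := by
    intro a
    refine IsRetractOfPower.piFamily (fun t : Fin (μ a) => M' (d a t)) fun t => ?_
    obtain ⟨s, heq⟩ := hdψ a t t.isLt
    exact (isRetractOfPower_fst (ModuleCat.of U (Π t, M' (ψ' t))) (ModuleCat.of U U)).of_isRetractOfPower_gen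
      ((isRetractOfPower_eval (fun t : Fin e => M' (ψ' t)) s).of_iso
        (LinearEquiv.toModuleIso (LinearEquiv.ofEq _ _ (by rw [heq]))))
  have hD : ∀ t, ∃ (s : Fin e) (ι : M' (ψ' t) ⟶ K (ψ' s)) (r : K (ψ' s) ⟶ M' (ψ' t)),
      ι ≫ r = 𝟙 (M' (ψ' t)) := by
    -- the NUMERATION LEMMA picks the source; the greedy staircase of the source class hits the target
    have hsrc : ∀ t : Fin e, ∃ (s : Fin e) (p : Fin (μ (ψ' s))), d (ψ' s) p = ψ' t := by
      intro t
      obtain ⟨w, hw1, hwe, hnum⟩ := exists_source_of_target hie hie1 hrec hb (t.val + 1) (by omega) t.isLt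
      let s : Fin e := ⟨w - 1, by omega⟩
      have hψs : ψ' s = -((i w : ℕ) : ZMod n) := by
        simp only [ψ', s, Nat.sub_add_cancel hw1]
      have hiw1 : 1 ≤ i w := one_le_of_chain hie hie1 h2 w hwe
      have hiwn : i w ≤ n := by rw [← hi0]; exact hile 0 w (Nat.zero_le _) (by omega)
      have hval : (ψ' s).val = n - i w := by rw [hψs]; exact val_neg_natCast hiw1 hiwn
      -- the greedy remainders of the source class `n - i w`
      let τ : ℕ → ℕ := fun r => Nat.rec (n - i w) (fun r v => v % i (r + 1)) r
      have hτ0 : τ 0 = n - i w := rfl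
      have hτs : ∀ r, 1 ≤ r → r ≤ e → τ r = τ (r - 1) % i r := by
        intro r hr1 _
        obtain ⟨r', rfl⟩ : ∃ r', r = r' + 1 := ⟨r - 1, by omega⟩
        rw [Nat.add_sub_cancel]
      have hdigit : i (t.val + 1) ≤ τ t.val := by
        have := hnum τ (by rw [hτ0, hi0]) hτs
        rwa [Nat.add_sub_cancel] at this
      obtain ⟨p, hpμ, hσp⟩ := exists_greedy_hit hie hie1 h2 (hcμ (ψ' s))
        (fun t' ht' => by
          obtain ⟨h1, h3, h4, h5, h6, -⟩ := hdrop (ψ' s) t' ht'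
          exact ⟨h1, h3, h4, h5, h6⟩)
        (by rw [hc0, hi0]; exact ZMod.val_lt _) τ (by rw [hτ0, hc0, hval]) hτs t.val (by omega) hdigit
      refine ⟨s, ⟨p, hpμ⟩, ?_⟩
      change -((i (σ (ψ' s) p) : ℕ) : ZMod n) = ψ' t
      rw [hσp]
    intro t
    obtain ⟨s, p, hp⟩ := hsrc t
    let E : M (d (ψ' s) p) ≃ₗ[U] M (ψ' t) := LinearEquiv.ofEq _ _ (by rw [hp])
    refine ⟨s,
      @ModuleCat.ofHom U _ (M (ψ' t)) (Π t' : Fin (μ (ψ' s)), M (d (ψ' s) t'))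
        _ (M (ψ' t)).module _ _
        ((LinearMap.single U (fun t' : Fin (μ (ψ' s)) => M (d (ψ' s) t')) p) ∘ₗ E.symm.toLinearMap),
      @ModuleCat.ofHom U _ (Π t' : Fin (μ (ψ' s)), M (d (ψ' s) t')) (M (ψ' t))
        _ _ _ (M (ψ' t)).module (E.toLinearMap ∘ₗ LinearMap.proj p), ?_⟩
    apply ModuleCat.hom_ext
    refine LinearMap.ext fun x => ?_
    change E ((Pi.single p (E.symm x) : Π t' : Fin (μ (ψ' s)), M (d (ψ' s) t')) p) = x
    rw [Pi.single_eq_same, LinearEquiv.apply_symm_apply]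
  obtain ⟨h4, hiff⟩ := @cohomologyAnnihilator_eq_four_of_isotypicData k _ n _ ζ hζ hn q hcop U hU (Fin e) _ M' eM
    K hK ψ' hfin hKD hD
  exact ⟨M, hM, h4, hiff⟩

include hζ hn hU in
/-- **`ca = ca⁴` FOR EVERY CYCLIC QUOTIENT SURFACE SINGULARITY.**  For `U = k[u,v]^{μ_n(1,q)}` with `q` coprime to
`n` (any residue; `ζ ∈ k` a primitive `n`-th root of unity, `n ∈ kˣ`): `ca(U) = ca⁴(U)`.  (Reduce `q` mod `n` —
`ζ^q = ζ^{q mod n}` — and run the Hirzebruch–Jung chain of `n/(q mod n)` (`exists_chain`); `n ∣ q` forces `n = 1`,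
the empty chain.) [OURS · cell decomp-res] -/
theorem cohomologyAnnihilator_eq_four_cyclicQuotient (hq : q.Coprime n) :
    cohomologyAnnihilator U = cohomologyAnnihilatorOfDegree U 4 := by
  classical
  have hnpos : 0 < n := Nat.pos_of_ne_zero (NeZero.ne n)
  -- reduce the weight mod `n`
  have hpow : ζ ^ q = ζ ^ (q % n) := by
    conv_lhs => rw [← Nat.mod_add_div q n, pow_add, pow_mul, hζ.pow_eq_one, one_pow, mul_one]
  have hfun : (fun l : Fin 2 => C (ζ ^ (![1, q] : Fin 2 → ℕ) l) * X l : Fin 2 → MvPolynomial (Fin 2) k) =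
      (fun l : Fin 2 => C (ζ ^ (![1, q % n] : Fin 2 → ℕ) l) * X l) := by
    funext l
    fin_cases l
    · rfl
    · simp [hpow]
  have hU' : ∀ p, p ∈ U ↔ aeval (fun l : Fin 2 => C (ζ ^ (![1, q % n] : Fin 2 → ℕ) l) * X l) p = p := by
    intro p; rw [← hfun]; exact hU p
  have hq'n : (q % n).Coprime n := by
    rw [Nat.coprime_iff_gcd_eq_one, ← Nat.gcd_rec, Nat.gcd_comm]
    exact hq
  rcases Nat.eq_zero_or_pos (q % n) with hq0 | hq0
  · -- `n ∣ q`: `n = 1`, the empty chain `i = (1, 0, …)`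
    have hn1 : n = 1 := by
      have h : Nat.gcd (q % n) n = 1 := hq'n
      rwa [hq0, Nat.gcd_zero_left] at h
    obtain ⟨-, -, h4, -⟩ := cohomologyAnnihilator_cyclicQuotient_of_chain hζ hn U hU' (e := 0)
      (i := fun s => if s = 0 then 1 else 0) (b := fun _ => 0) (by rw [if_pos rfl, hn1])
      (by rw [if_neg one_ne_zero, hq0]) (by rw [if_pos rfl]) (by rw [if_neg (by omega)])
      (fun s hs1 hs0 => by omega) (fun s hs1 hs0 => by omega)
    exact h4
  · obtain ⟨e, i, b, -, hi0, hi1, hie, hie1, hrec, hb⟩ :=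
      exists_chain n (q % n) hq0 (Nat.mod_lt _ hnpos) hq'n.symm
    obtain ⟨-, -, h4, -⟩ := cohomologyAnnihilator_cyclicQuotient_of_chain hζ hn U hU' hi0 hi1 hie hie1 hrec hb
    exact h4

end Summit.ResolutionOfSingularities.ResolutionOfSingularities.Theorems.HomologicalConductor.PersistenceCyclicQuotientAll

end
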